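/-
Copyright: cell `pub-ymgap` (HUMAN RULING D-0062), Track A of `YM-PLAN.md`, DAG node N21 (= NE7c); R134 acceleration seat
`pub-ymgap-dag-n21-c` (generation 3).  Released under the licence of the surrounding project.
-/
import Literature.MathematicalPhysics.QuantumFieldTheory.Balaban1983to89.BlockAveragingEMLProp2
import Summits.QuantumFields.YangMills.Theorems.BalabanUVNodesN20LCSAvgDomination
import Summits.QuantumFields.YangMills.Theorems.BalabanUVNodesN20LCSAvgDominationRegion
import HarnessLib

/-!
# YM-DAG node N21 (= NE7c): [Balaban1985Averaging] PROPOSITION 1 (51) FOR THE (0.4) AVERAGING OF RECORD, SHARP (SECOND ORDER) **AND LOCAL**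
# — the printed locality clause «the bound above depends on bounds for V(∂p) − 1 on Δ(p′)» (p. 25) for `blockAvg expMeanLogSU`, PROVED

Track A of `YM-PLAN.md` (cell `pub-ymgap`, HUMAN RULING D-0062), node **N21** = spine estimate NE7c (`T4IndicatorShell.ShellWeightBound` — the cell
`pub-balaban`'s OWN estimate, NOT PRINTED in [Bałaban 1983–89], NOT PROVED).  Seat `pub-ymgap-dag-n21-c` (director-ym R134 row s1), generation 3,
successor item S4a of the generation-2 HANDOFF («LOCAL form of Prop 1∕2 — hypothesis only on the blocks around p′ — the one-call END's box-localised
`hcore` literally»).  Kernel theorems only: 0 `def`, 0 `sorry`, standard axioms; COUNT-NEUTRAL (`--supports stmt-QuantumFields-19908 --as helper`).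

THE PRINTED TEXT ([Balaban1985Averaging] = T. Bałaban, *Averaging operations for lattice gauge theories*, Commun. Math. Phys. **98** (1985) 17–51,
pp. 25–26, verbatim from the tree leaf `B7Prop1Local`, which READ the pages): *«This is the estimate we are looking for. Let us notice that it is a local
result; the bound above depends on bounds for V(∂p) − 1 on Δ(p′), i.e., for p ⊂ Δ(p′).»*; *«PROPOSITION 1. There exist positive constants C₀, c₂′ such
that for every configuration V satisfying (44) for p ⊂ Δ(p′) and for α₀ ≤ c₂′, we have |V̄(∂p′) − 1| < L²α₀ + C₀(L²α₀)². (51)»*.  [Balaban1987RG1]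
p. 253: *«The considerations and results of this, and previous papers, do not depend on any particular averaging operation used»*.

WHY THIS FILE EXISTS.  The tree certifies Prop. 1 WITH ITS LOCALITY for [B7]'s own average (42) on `ℤᵈ` (`B7Prop1Local.prop1_local`, by a clamped
extension of the configuration off the box).  For the averaging OF RECORD of the T⁴ programme — [Balaban1987RG1] (0.3)–(0.4) `BlockAveraging.blockAvg
ExpMeanLog.expMeanLogSU` on the torus (`Node00.avOfRecord`) — the tree had (i) the SHARP Prop. 1 under GLOBAL smallness (this seat's generation 2,
`BlockAveragingEMLProp2.dist1_plaqHol_avgFun_le`, `∀ q, |U(∂q) − 1| ≤ a`), and (ii) the LOCAL but CRUDE one-step bound of seat `pub-ymgap-dag-n20-d`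
(`N20LCSAvgDomination.dist1_plaqHol_avgFun_le_loc`, constant `(L² + 6((d+2)L)²)·δ`, whose first-order coefficient is not `L²` and therefore iterates
exponentially in the number of levels).  The consumers on N21's side are LOCAL: the one-call END's γ3 readings `hcore ∕ hcollar` are BOX-LOCALISED
(«slot variable of the minimiser small ⇒ datum `a`-small ON THE BOX `Pcore`»), and [Balaban1989LargeFieldI–II]'s multi-scale backgrounds `U_{k,Z}` are
regular only on hierarchies of regions.  THIS FILE proves the sharp Prop. 1 under the WALK-LOCAL hypothesis of the tree's local Stokes letters — the
plaquettes cornered at the sites `walkEnd (emb p′₋) v`, `|v| ≤ (d+4)L + 2`, within `a` of `1` — with the SAME constants as the global theorem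
(first order EXACTLY `L²a`, second order `143·((((d+4)L)²/4)·a)² = C₀(d)(L²a)²`), so that the (53) induction closes level by level on shrinking boxes
(companion `…N21LocalAveragedRegularityLevels`: the local Prop. 2, K-uniform, and the END's `hcore` species in box-local form at `Node00.Uk`).

HOW (all cited inputs BY NAME; nothing of [B7] re-proved here).  Generation 3's v1.1 of `BlockAveragingEMLProp2` ATOMISED the sharp Prop. 1:
`dist1_plaqHol_avgFun_le_of_atoms` takes as hypotheses only the sizes of the atoms the proof consumes — (W) every (0.4) loop variable `loopHol U c i` at
the four bonds `c` of `∂p′` within `(((d+2)L)²/4)·a`; (Z) every transport loop of the coupled index within `(((d+4)L)²/4)·a`; (Q) the straight coarse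
square `rect U (emb y) μ ν L L` and every translated square `rect U (walkEnd (emb y) Γ^σ(n)) μ ν L L` within `L²a`.  §1 bounds each atom from the
walk-local hypothesis at the block centre `emb p′₋` with radius `(d+4)L + 2`: (W) by `HistoryTailStokesLocal.dist1_loopHol_le_loc` (route `UnitScaleTilt`,
p443816) — for the bonds at `y + e_μ`, `y + e_ν` the walk is prefixed by `(+e_μ)^L` (`BlockAveragingEMLProp2.emb_shift_eq_shiftN`,
`N20LCSAvgDomination.shiftN_eq_walkEnd_replicate`); (Z) by `HistoryTailStokesLocal.dist1_holAt_le_loc` on the closed word of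
`BlockAveragingEMLProp2.netDisp_zWord ∕ length_zWord_le`; (Q) by the exact lattice Stokes SUM `B10Eq47AxialChi.dist1_rect_le` (the `L²` plaquettes of
the square are walk sites: `N20LCSAvgDomination.shiftN_shiftN_eq_walkEnd`, `LatticeWordStokes.length_stairWord_le`).  §2 assembles
**`dist1_plaqHol_avgFun_le_sharp_loc`** and its box form **`dist1_plaqHol_avgFun_le_sharp_of_boxRegion`** (hypothesis on n20-d's
`N20LCSAvgDominationRegion.boxRegion (emb p′₋) ((d+4)L + 2)`, via `HistoryTailWalkLocality.walkLocal_of_box`).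

HONEST FRAMING.  The locality radius is `(d+4)L + 2` fine steps in `ℓ^∞` around the block centre `emb p′₋` — the walk hull of the tree's CRUDE Stokes
letters (every intermediate word of the cancellation algorithm is charged), not the printed four blocks `Δ(p′)`; in coarse units this is `≈ d + 5`
blocks around `p′₋` (print: 2).  Nothing of Bałaban's is asserted; NE7c NOT PRINTED ∕ NOT PROVED; (M1) ∕ NODE O untouched; N21 NOT discharged; typed
28∕28, discharged count untouched; one finite torus at fixed `ε` — NOT ℝ⁴, NOT infinite volume, NOT OS, NOT a mass gap, NOT Clay.

References: T. Bałaban, CMP 98 (1985) 17–51 [Balaban1985Averaging] (Prop. 1 (51) pp. 25–26, (19)–(20) p. 21); CMP 109 (1987) 249–301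
[Balaban1987RG1] ((0.3)–(0.4) pp. 252–253).
-/

noncomputable section

open scoped BigOperators

namespace Summit.QuantumFields.YangMills.Theorems.N21LocalAveragedRegularity

open Literature.MathematicalPhysics.QuantumFieldTheory.Balaban1983to89
open T4Continuum T4ReflectionCone BlockAveraging AveragingRT B10Eq47AxialChi ExpMeanLog LatticeWordStokes BlockAveragingEMLProp2
open Summit.QuantumFields.YangMills.Theorems.HistoryTailStokesLocal (dist1_loopHol_le_loc dist1_holAt_le_loc)
open Summit.QuantumFields.YangMills.Theorems.HistoryTailWalkLocality (walkLocal_of_box)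
open Summit.QuantumFields.YangMills.BalabanUVNodes.N20LCSAvgDomination (walkLocal_mono shiftN_eq_walkEnd_replicate shiftN_shiftN_eq_walkEnd)
open Summit.QuantumFields.YangMills.BalabanUVNodes.N20LCSAvgDominationRegion (boxRegion mem_boxRegion mem_boxRegion_of_corner)

variable {P : Params} {j : ℕ}

/-! ## §1 The atoms of the sharp Prop. 1 under the walk-local hypothesis at the block centre -/

section Atoms

variable {G : Type*} [GaugeGroup G]

/-- **MOVING THE BASE OF A WALK-LOCAL HYPOTHESIS**: smallness of the plaquettes cornered at `walkEnd x v`, `|v| ≤ R`, gives smallness of those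
cornered at `walkEnd (walkEnd x u) v`, `|v| ≤ R′`, whenever `|u| + R′ ≤ R` (concatenate the walks). [folklore] -/
theorem walkLocal_walkEnd (U : GaugeField P j G) (x : Site P j) (u : List (Letter P.d)) {R R' : ℕ} (hR : u.length + R' ≤ R) {δ : ℝ}
    (hU : ∀ v : List (Letter P.d), v.length ≤ R →
      ∀ (a b : Fin P.d) (h : a < b), dist1 (GaugeField.plaqHol U ⟨walkEnd x v, a, b, h⟩) ≤ δ) :
    ∀ v : List (Letter P.d), v.length ≤ R' →
      ∀ (a b : Fin P.d) (h : a < b), dist1 (GaugeField.plaqHol U ⟨walkEnd (walkEnd x u) v, a, b, h⟩) ≤ δ := by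
  intro v hv a b hab
  rw [← walkEnd_append]
  exact hU _ (by rw [List.length_append]; omega) a b hab

/-- **ATOM (W) AT THE BONDS ISSUING FROM `p′₋`**: the (0.4) loop variables at `⟨y, κ⟩` are within `(((d+2)L)²/4)·a` of `1` when the plaquettes
cornered at `walkEnd (emb y) v`, `|v| ≤ R`, `R ≥ (d+2)L + 2`, are within `a ≥ 0` of `1` (`HistoryTailStokesLocal.dist1_loopHol_le_loc` BY NAME).
[cite: Balaban1987RG1, (0.4) p.253] -/
theorem dist1_loopHol_le_loc_src {a : ℝ} (ha : 0 ≤ a) (U : GaugeField P j G) (y : Site P (j + 1)) {R : ℕ} (hR : (P.d + 2) * P.L + 2 ≤ R)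
    (hU : ∀ v : List (Letter P.d), v.length ≤ R →
      ∀ (a' b : Fin P.d) (h : a' < b), dist1 (GaugeField.plaqHol U ⟨walkEnd (emb y) v, a', b, h⟩) ≤ a)
    (κ : Fin P.d) (i : Idx P) :
    dist1 (loopHol U ⟨y, κ⟩ i) ≤ ((((P.d + 2) * P.L : ℕ) : ℝ) ^ 2 / 4) * a :=
  dist1_loopHol_le_loc U ha ⟨y, κ⟩ (walkLocal_mono U (emb y) hR hU) i

/-- **ATOM (W) AT THE BONDS ISSUING FROM A NEIGHBOURING BLOCK CENTRE `y + e_μ`**: the loop variables at `⟨y + e_μ, κ⟩` are within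
`(((d+2)L)²/4)·a` of `1` when the plaquettes cornered at `walkEnd (emb y) v`, `|v| ≤ R`, `R ≥ (d+3)L + 2`, are within `a` of `1` — the walk from
`emb y` is prefixed by the straight walk `(+e_μ)^L` to `emb (y + e_μ)`. [cite: Balaban1987RG1, (0.3)–(0.4) pp.252–253] -/
theorem dist1_loopHol_le_loc_shift {a : ℝ} (ha : 0 ≤ a) (U : GaugeField P j G) (y : Site P (j + 1)) {R : ℕ} (hR : (P.d + 3) * P.L + 2 ≤ R)
    (hU : ∀ v : List (Letter P.d), v.length ≤ R →
      ∀ (a' b : Fin P.d) (h : a' < b), dist1 (GaugeField.plaqHol U ⟨walkEnd (emb y) v, a', b, h⟩) ≤ a)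
    (μ κ : Fin P.d) (i : Idx P) :
    dist1 (loopHol U ⟨y.shift μ, κ⟩ i) ≤ ((((P.d + 2) * P.L : ℕ) : ℝ) ^ 2 / 4) * a := by
  refine dist1_loopHol_le_loc U ha ⟨y.shift μ, κ⟩ ?_ i
  have hb : emb (y.shift μ) = walkEnd (emb y) (List.replicate P.L (μ, true)) := by
    rw [emb_shift_eq_shiftN, shiftN_eq_walkEnd_replicate]
  rw [show (⟨y.shift μ, κ⟩ : PBond P (j + 1)).src = y.shift μ from rfl, hb]
  refine walkLocal_walkEnd U (emb y) _ ?_ hU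
  have e : (P.d + 3) * P.L = (P.d + 2) * P.L + P.L := by ring
  rw [List.length_replicate]
  omega

/-- **ATOM (Z), THE TRANSPORT LOOPS**: the closed word `Γ^σ(n) (+e_μ)^L (+e_ν)^L rev Γ^ρ(n) (−e_ν)^L (−e_μ)^L` from `emb y` (length `≤ (d+4)L`,
zero net displacement: `BlockAveragingEMLProp2.length_zWord_le ∕ netDisp_zWord`) has holonomy within `(((d+4)L)²/4)·a` of `1` when the plaquettes
cornered at `walkEnd (emb y) v`, `|v| ≤ R`, `R ≥ (d+4)L + 2`, are within `a ≥ 0` of `1` (`HistoryTailStokesLocal.dist1_holAt_le_loc` BY NAME).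
[cite: Balaban1985Averaging, (19)–(20) p.21] -/
theorem dist1_zWord_le_loc {a : ℝ} (ha : 0 ≤ a) (U : GaugeField P j G) (y : Site P (j + 1)) {R : ℕ} (hR : (P.d + 4) * P.L + 2 ≤ R)
    (hU : ∀ v : List (Letter P.d), v.length ≤ R →
      ∀ (a' b : Fin P.d) (h : a' < b), dist1 (GaugeField.plaqHol U ⟨walkEnd (emb y) v, a', b, h⟩) ≤ a)
    (μ ν : Fin P.d) (σ ρ : Equiv.Perm (Fin P.d)) (r : Fin P.d → Fin P.L) :
    dist1 (holAt U (walk (emb y) (stairWord σ (off r) ++ (List.replicate P.L (μ, true) ++ (List.replicate P.L (ν, true) ++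
        (wordRev (stairWord ρ (off r)) ++ (List.replicate P.L (ν, false) ++ List.replicate P.L (μ, false)))))))) ≤
      ((((P.d + 4) * P.L : ℕ) : ℝ) ^ 2 / 4) * a := by
  have hlen := length_zWord_le (P := P) μ ν σ ρ r
  have h := dist1_holAt_le_loc U (emb y) ha (N := (P.d + 4) * P.L) (walkLocal_mono U (emb y) hR hU) _ hlen
    (netDisp_zWord μ ν σ ρ (off r))
  refine h.trans (mul_le_mul_of_nonneg_right ?_ ha)
  have hlen' : ((stairWord σ (off r) ++ (List.replicate P.L (μ, true) ++ (List.replicate P.L (ν, true) ++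
        (wordRev (stairWord ρ (off r)) ++ (List.replicate P.L (ν, false) ++ List.replicate P.L (μ, false)))))).length : ℝ)
      ≤ (((P.d + 4) * P.L : ℕ) : ℝ) := by exact_mod_cast hlen
  have h0 : (0 : ℝ) ≤ ((stairWord σ (off r) ++ (List.replicate P.L (μ, true) ++ (List.replicate P.L (ν, true) ++
        (wordRev (stairWord ρ (off r)) ++ (List.replicate P.L (ν, false) ++ List.replicate P.L (μ, false)))))).length : ℝ) :=
    Nat.cast_nonneg _
  gcongr

/-- **ATOM (Q), THE STRAIGHT COARSE SQUARE**: the `L × L` square at `emb y` is within `L²a` of `1` when the plaquettes cornered at `walkEnd (emb y) v`,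
`|v| ≤ R`, `R ≥ 2L`, are within `a` of `1` — the exact lattice Stokes SUM `B10Eq47AxialChi.dist1_rect_le` over the `L²` plaquettes of the square, each a
walk site `(+e_ν)^t (+e_μ)^s`. [cite: Balaban1985Averaging, (19) p.21] -/
theorem dist1_rect_LL_le_loc {a : ℝ} (U : GaugeField P j G) (y : Site P (j + 1)) {R : ℕ} (hR : 2 * P.L ≤ R)
    (hU : ∀ v : List (Letter P.d), v.length ≤ R →
      ∀ (a' b : Fin P.d) (h : a' < b), dist1 (GaugeField.plaqHol U ⟨walkEnd (emb y) v, a', b, h⟩) ≤ a)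
    {μ ν : Fin P.d} (hμν : μ < ν) :
    dist1 (rect U (emb y) μ ν P.L P.L) ≤ (P.L : ℝ) ^ 2 * a := by
  refine (dist1_rect_le U (emb y) hμν P.L P.L).trans ?_
  calc ∑ t ∈ Finset.range P.L, ∑ s ∈ Finset.range P.L,
        dist1 (GaugeField.plaqHol U ⟨shiftN (shiftN (emb y) ν t) μ s, μ, ν, hμν⟩)
      ≤ ∑ _t ∈ Finset.range P.L, ∑ _s ∈ Finset.range P.L, a :=
        Finset.sum_le_sum fun t ht => Finset.sum_le_sum fun s hs => by
          have ht' := Finset.mem_range.mp ht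
          have hs' := Finset.mem_range.mp hs
          rw [shiftN_shiftN_eq_walkEnd]
          exact hU _ (by rw [List.length_append, List.length_replicate, List.length_replicate]; omega) μ ν hμν
    _ = (P.L : ℝ) ^ 2 * a := by simp [Finset.sum_const, Finset.card_range]; ring

/-- **ATOM (Q′), THE TRANSLATED SQUARES `(p′)_x`**: the `L × L` square at `x = walkEnd (emb y) Γ^σ(n)` (`n = off r`, `|n_κ| ≤ (L−1)/2`, so
`|Γ^σ(n)| ≤ d(L−1)/2`: `LatticeWordStokes.length_stairWord_le`) is within `L²a` of `1` when the plaquettes cornered at `walkEnd (emb y) v`, `|v| ≤ R`,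
`R ≥ (d+4)L`, are within `a` of `1`. [cite: Balaban1985Averaging, (19) p.21; Balaban1987RG1, (0.3) p.252] -/
theorem dist1_rect_stair_le_loc {a : ℝ} (U : GaugeField P j G) (y : Site P (j + 1)) {R : ℕ} (hR : (P.d + 4) * P.L ≤ R)
    (hU : ∀ v : List (Letter P.d), v.length ≤ R →
      ∀ (a' b : Fin P.d) (h : a' < b), dist1 (GaugeField.plaqHol U ⟨walkEnd (emb y) v, a', b, h⟩) ≤ a)
    {μ ν : Fin P.d} (hμν : μ < ν) (σ : Equiv.Perm (Fin P.d)) (r : Fin P.d → Fin P.L) :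
    dist1 (rect U (walkEnd (emb y) (stairWord σ (off r))) μ ν P.L P.L) ≤ (P.L : ℝ) ^ 2 * a := by
  have hn : ∀ κ, (off r κ).natAbs ≤ (P.L - 1) / 2 := fun κ => by
    have h := off_bounds r κ
    omega
  have hlen := length_stairWord_le σ (off r) _ hn
  have hdL : P.d * ((P.L - 1) / 2) ≤ P.d * P.L := Nat.mul_le_mul_left _ (by omega)
  have e : (P.d + 4) * P.L = P.d * P.L + 4 * P.L := by ring
  refine (dist1_rect_le U _ hμν P.L P.L).trans ?_
  calc ∑ t ∈ Finset.range P.L, ∑ s ∈ Finset.range P.L,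
        dist1 (GaugeField.plaqHol U ⟨shiftN (shiftN (walkEnd (emb y) (stairWord σ (off r))) ν t) μ s, μ, ν, hμν⟩)
      ≤ ∑ _t ∈ Finset.range P.L, ∑ _s ∈ Finset.range P.L, a :=
        Finset.sum_le_sum fun t ht => Finset.sum_le_sum fun s hs => by
          have ht' := Finset.mem_range.mp ht
          have hs' := Finset.mem_range.mp hs
          rw [shiftN_shiftN_eq_walkEnd, ← walkEnd_append]
          refine hU _ ?_ μ ν hμν
          rw [List.length_append, List.length_append, List.length_replicate, List.length_replicate]
          omega
    _ = (P.L : ℝ) ^ 2 * a := by simp [Finset.sum_const, Finset.card_range]; ring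

end Atoms

/-! ## §2 Proposition 1 (51) for (0.4), SHARP AND LOCAL -/

section Prop1

open scoped Matrix.Norms.L2Operator

variable {n : Type*} [Fintype n] [DecidableEq n] [Nonempty n]

/-- **[Balaban1985Averaging] PROPOSITION 1 (51) FOR THE (0.4) AVERAGING OF RECORD (`exp[mean log]` on `SU(N)`), SHARP AND LOCAL — PROVED.**
For a coarse plaquette `p′` of `T^{(j+1)}`: if every fine plaquette cornered at a site `walkEnd (emb p′₋) v`, `|v| ≤ (d+4)L + 2`, is within `a ≥ 0` of
`1`, and `(((d+4)L)²/4)·a ≤ δ_N/2`, then `|Ū(∂p′) − 1| ≤ L²a + 143·((((d+4)L)²/4)·a)²` (`= L²a + C₀(d)(L²a)²`, `C₀(d) = 143((d+4)²/4)²`) — the SAME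
constants as the global `BlockAveragingEMLProp2.dist1_plaqHol_avgFun_le`, with NO hypothesis on any other plaquette of the torus.  Print: *«it is a
local result; the bound above depends on bounds for V(∂p) − 1 on Δ(p′)»* (p. 25) — here `Δ(p′)` is replaced by the walk hull of radius `(d+4)L + 2`
around the block centre (HONEST FRAMING of the header).  The atomised theorem `dist1_plaqHol_avgFun_le_of_atoms` fed with §1.
[cite: Balaban1985Averaging, Prop. 1 (51) pp.25–26] -/
theorem dist1_plaqHol_avgFun_le_sharp_loc {a : ℝ} (ha : 0 ≤ a) {U : GaugeField P j (Matrix.specialUnitaryGroup n ℂ)}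
    (hs : ((((P.d + 4) * P.L : ℕ) : ℝ) ^ 2 / 4) * a ≤ deltaSU n / 2) (p : Plaq P (j + 1))
    (hU : ∀ v : List (Letter P.d), v.length ≤ (P.d + 4) * P.L + 2 →
      ∀ (a' b : Fin P.d) (h : a' < b), dist1 (GaugeField.plaqHol U ⟨walkEnd (emb p.src) v, a', b, h⟩) ≤ a) :
    dist1 (GaugeField.plaqHol (avgFun (expMeanLogSU (n := n)) U) p) ≤
      (P.L : ℝ) ^ 2 * a + 143 * (((((P.d + 4) * P.L : ℕ) : ℝ) ^ 2 / 4) * a) ^ 2 := by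
  obtain ⟨y, μ, ν, hμν⟩ := p
  have e3 : (P.d + 3) * P.L + P.L = (P.d + 4) * P.L := by ring
  have e2 : (P.d + 2) * P.L + P.L = (P.d + 3) * P.L := by ring
  have h2 : (P.d + 2) * P.L + 2 ≤ (P.d + 4) * P.L + 2 := by omega
  have h3 : (P.d + 3) * P.L + 2 ≤ (P.d + 4) * P.L + 2 := by omega
  have hdL : 2 * P.L ≤ (P.d + 4) * P.L := Nat.mul_le_mul_right _ (by omega)
  have h4 : 2 * P.L ≤ (P.d + 4) * P.L + 2 := by omega
  have h5 : (P.d + 4) * P.L ≤ (P.d + 4) * P.L + 2 := by omega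
  exact dist1_plaqHol_avgFun_le_of_atoms ha hs y hμν (dist1_loopHol_le_loc_src ha U y h2 hU μ)
    (dist1_loopHol_le_loc_shift ha U y h3 hU μ ν) (dist1_loopHol_le_loc_shift ha U y h3 hU ν μ) (dist1_loopHol_le_loc_src ha U y h2 hU ν)
    (fun r σ ρ => dist1_zWord_le_loc ha U y le_rfl hU μ ν σ ρ r) (dist1_rect_LL_le_loc U y h4 hU hμν)
    (fun r σ => dist1_rect_stair_le_loc U y h5 hU hμν σ r)

/-- **THE BOX FORM**: if every fine plaquette of n20-d's box region `boxRegion (emb p′₋) ((d+4)L + 2)` (corner in the `ℓ^∞`-ball of radius `(d+4)L + 2`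
around the block centre) is within `a ≥ 0` of `1` and `(((d+4)L)²/4)·a ≤ δ_N/2`, then `|Ū(∂p′) − 1| ≤ L²a + 143·((((d+4)L)²/4)·a)²`
(`HistoryTailWalkLocality.walkLocal_of_box`: a walk of length `≤ ρ` ends in the `ℓ^∞`-ball of radius `ρ`). [cite: Balaban1985Averaging, Prop. 1 (51) pp.25–26] -/
theorem dist1_plaqHol_avgFun_le_sharp_of_boxRegion {a : ℝ} (ha : 0 ≤ a) {U : GaugeField P j (Matrix.specialUnitaryGroup n ℂ)}
    (hs : ((((P.d + 4) * P.L : ℕ) : ℝ) ^ 2 / 4) * a ≤ deltaSU n / 2) (p : Plaq P (j + 1))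
    (hU : ∀ q ∈ boxRegion (emb p.src) ((P.d + 4) * P.L + 2), dist1 (GaugeField.plaqHol U q) ≤ a) :
    dist1 (GaugeField.plaqHol (avgFun (expMeanLogSU (n := n)) U) p) ≤
      (P.L : ℝ) ^ 2 * a + 143 * (((((P.d + 4) * P.L : ℕ) : ℝ) ^ 2 / 4) * a) ^ 2 :=
  dist1_plaqHol_avgFun_le_sharp_loc ha hs p
    (walkLocal_of_box U (emb p.src) _ fun z hz a' b h => hU _ (mem_boxRegion_of_corner z hz a' b h))

/-- **THE BOX FORM, `PlaqSmallOn` CURRENCY** (strict levels, as the large-field literature and the one-call END's `hcore ∕ hcollar` read them): for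
`0 < a` with `(((d+4)L)²/4)·a ≤ δ_N/2`, `PlaqSmallOn (boxRegion (emb p′₋) ((d+4)L + 2)) a U ⇒ |Ū(∂p′) − 1| < L²a + 143·((((d+4)L)²/4)·a)²`
(a finite box has a strictly smaller non-strict level). [cite: Balaban1985Averaging, Prop. 1 (51) pp.25–26] -/
theorem dist1_plaqHol_avgFun_lt_sharp_of_plaqSmallOn {a : ℝ} (ha : 0 < a) {U : GaugeField P j (Matrix.specialUnitaryGroup n ℂ)}
    (hs : ((((P.d + 4) * P.L : ℕ) : ℝ) ^ 2 / 4) * a ≤ deltaSU n / 2) (p : Plaq P (j + 1))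
    (hU : PlaqSmallOn (↑(boxRegion (emb p.src) ((P.d + 4) * P.L + 2)) : Set (Plaq P j)) a U) :
    dist1 (GaugeField.plaqHol (avgFun (expMeanLogSU (n := n)) U) p) <
      (P.L : ℝ) ^ 2 * a + 143 * (((((P.d + 4) * P.L : ℕ) : ℝ) ^ 2 / 4) * a) ^ 2 := by
  classical
  set S := boxRegion (emb p.src) ((P.d + 4) * P.L + 2) with hS
  -- a strictly smaller non-strict level `a′ < a` on the finite box
  obtain ⟨a', ha'0, ha'a, hU'⟩ : ∃ a', 0 ≤ a' ∧ a' < a ∧ ∀ q ∈ S, dist1 (GaugeField.plaqHol U q) ≤ a' := by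
    by_cases hne : S.Nonempty
    · obtain ⟨q₀, hq₀S, hq₀⟩ := Finset.exists_mem_eq_sup' hne fun q => dist1 (GaugeField.plaqHol U q)
      refine ⟨S.sup' hne fun q => dist1 (GaugeField.plaqHol U q), ?_, ?_,
        fun q hq => Finset.le_sup' (fun q => dist1 (GaugeField.plaqHol U q)) hq⟩
      · rw [hq₀]; exact GaugeGroup.dist1_nonneg _
      · rw [hq₀]; exact hU q₀ (Finset.mem_coe.mpr hq₀S)
    · exact ⟨0, le_rfl, ha, fun q hq => absurd ⟨q, hq⟩ hne⟩
  have hs' : ((((P.d + 4) * P.L : ℕ) : ℝ) ^ 2 / 4) * a' ≤ deltaSU n / 2 :=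
    (mul_le_mul_of_nonneg_left ha'a.le (by positivity)).trans hs
  refine (dist1_plaqHol_avgFun_le_sharp_of_boxRegion ha'0 hs' p hU').trans_lt ?_
  have hL : (0 : ℝ) < (P.L : ℝ) ^ 2 := by have := P.L_pos; positivity
  have h1 : (P.L : ℝ) ^ 2 * a' < (P.L : ℝ) ^ 2 * a := mul_lt_mul_of_pos_left ha'a hL
  have h2 : (((((P.d + 4) * P.L : ℕ) : ℝ) ^ 2 / 4) * a') ^ 2 ≤ (((((P.d + 4) * P.L : ℕ) : ℝ) ^ 2 / 4) * a) ^ 2 := by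
    gcongr
  linarith

end Prop1

end Summit.QuantumFields.YangMills.Theorems.N21LocalAveragedRegularity

end
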